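import Summits.QuantumFields.GaugeBoot.TiltedLatticeAxisRPNegative
import Summits.QuantumFields.GaugeBoot.TiltedBoxAxisFlips
import HarnessLib

/-!
# Axis reflection positivity FAILS along the axes `i`, `j` of the 45°-tilted periodic box (gauge-boot, L3 negative supplement, part 2)

HONEST FRAMING (cell `pub-gaugeboot`, page 1 of every file): the venture produces certified bounds
on lattice expectations at stated coupling, gauge group, dimension and torus size; NOT a mass gap,
NOT a continuum limit, NOT a string tension; NOT Yang–Mills-summit-bearing (barriers
`FixedCouplingUltralocality`, `PerturbativeInvisibility`). This module is a small NEGATIVE result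
about which positivity blocks a certificate on the tilted box may use; it discharges nothing else.

The tilted box `TiltedSite d i j M_u M_v L` (`TiltedBox.lean`) carries, as theorems, site and link RP
along every axis `k ∉ {i, j}` (`tiltedBox_siteRP`, `tiltedBox_linkRP`), diagonal RP in `x_i = x_j`
(`tiltedBox_diagonalRP`) and, if square, anti-diagonal RP (`tiltedBox_antiDiagonalRP`); the flips
`x_i ↦ -x_i`, `x_j ↦ -x_j` of the square box are SYMMETRIES of `μ_β` (`tiltedBox_integral_comp_flip`).
Whether they are reflections OF POSITIVE TYPE was undecided (Fröhlich–Israel–Lieb–Simon 1980 §3: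
the box is taken "at the cost of losing the other RP"). Decided here, negatively, in both senses:

* **`not_isSiteFrame_tiltedBox_inPlane`** — on EVERY tilted box (`M_u ≥ 1`, `i ≠ j`), for EVERY
  additive reflection `θ`, half period `P` and height `h` there is NO site frame `IsSiteFrame e m θ P h`
  (`TiltedSiteRPGeometry.lean`; the common hypothesis of the tree's site-RP theorem
  `IsSiteFrame.integral_conj_mul_nonneg` and link-RP theorem
  `IsSiteFrame.linkRP_integral_conj_mul_nonneg`) along an in-plane axis `m ∈ {i, j}`: a height with
  `h(e_i) + h(e_j) = 1` vanishes on `M_u(e_i + e_j) ∈ Γ`, forcing `2P ∣ M_u`, while the layer site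
  `P e_m` (height `P`) is `θ`-fixed only if `2P e_m ∈ Γ`, i.e. `M_u ∣ P` — incompatible with `P ≥ 2`.
* **`tiltedBox_axisRP_neg`**, **`not_tiltedBox_axisRP`** — on the square box of EVEN side parameter
  `M_u = M_v = 2P` (`P ≥ 1`, `L ≥ 1`, `i ≠ j`) with the flip `Θ_i` along `i` (`tiltedAxisFlip`;
  `i`-links reversed and inverted) and the closed half `{0 ≤ x_i ≤ P (mod 2P)}` read through the
  coordinate `tiltedAxisCoord = x_i mod 2P` (well defined on this box), the layer `x_i ≡ P` is mapped
  to itself but NOT pointwise (`[P e_i] ↦ [-P e_i] ≠ [P e_i]` since `2P e_i ∉ Γ`,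
  `tiltedAxisFlip_layerSite_ne`); the `j`-links based at `[P e_i]`, `[-P e_i]` both lie in the closed
  half, so by `IsAxisFlip.exists_integral_conj_mul_neg` closed-half RP in the shape of
  `tiltedBox_siteRP` FAILS at every real `β` (non-trivial compact Hausdorff second countable `G`,
  continuous `ρ`) — the failure mode of the diagonal mirror on the cubic torus
  (`DiagonalRPTorusNegative.lean`) transported to the axis mirror of the tilted box.

So along `i`, `j` the flips enter a tilted-box SDP only as symmetries (loop identifications), never
as PSD blocks; the positivity cone recorded in `TiltedBoxLinkRP.lean` is complete on this side.

References: J. Fröhlich, R. Israel, E. H. Lieb, B. Simon, J. Stat. Phys. 22 (1980) 297, §3 (Model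
3.1); K. Osterwalder, E. Seiler, Ann. Phys. 110 (1978) 440, §2; M. Biskup, in LNM 1970 (2009)
§5.4–5.5; V. Kazakov, Z. Zheng, arXiv:2203.11360 §3.1 (the three reflection positivities).
-/

noncomputable section

open MeasureTheory Complex QuotientAddGroup
open scoped ComplexOrder ComplexConjugate

namespace Summit.QuantumFields.GaugeBoot

namespace TiltedRP

/-! ## No site frame along an in-plane axis of a tilted box -/

section NoFrame

variable (d : ℕ) {i j : Fin d} (Mu Mv L : ℕ)

/-- `M_u (e_i + e_j) ∈ Γ`: in the box, `M_u • e_i + M_u • e_j = 0`. -/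
theorem tiltedUnit_inPlane_sum_eq_zero (hij : i ≠ j) :
    (Mu : ℤ) • tiltedUnit d i j Mu Mv L i + (Mu : ℤ) • tiltedUnit d i j Mu Mv L j = 0 := by
  have hΓ : ((Mu : ℤ) • (Pi.single i (1 : ℤ) + Pi.single j (1 : ℤ)) : Fin d → ℤ) ∈
      tiltedLattice d i j Mu Mv L := by
    rw [mem_tiltedLattice_iff]
    simp only [Pi.smul_apply, Pi.add_apply, Pi.single_eq_same, Pi.single_eq_of_ne hij,
      Pi.single_eq_of_ne hij.symm, smul_eq_mul, add_zero, zero_add, mul_one, sub_self, dvd_zero,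
      true_and]
    refine ⟨⟨1, by push_cast; ring⟩, fun k hki hkj => ?_⟩
    rw [Pi.single_eq_of_ne hki, Pi.single_eq_of_ne hkj, add_zero, mul_zero]
    exact dvd_zero _
  have h0 := (QuotientAddGroup.eq_zero_iff _).2 hΓ
  have hmk : ((((Mu : ℤ) • (Pi.single i (1 : ℤ) + Pi.single j (1 : ℤ)) : Fin d → ℤ)) :
      TiltedSite d i j Mu Mv L) =
      (Mu : ℤ) • tiltedUnit d i j Mu Mv L i + (Mu : ℤ) • tiltedUnit d i j Mu Mv L j := by
    show QuotientAddGroup.mk' (tiltedLattice d i j Mu Mv L)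
        ((Mu : ℤ) • ((Pi.single i (1 : ℤ) : Fin d → ℤ) + Pi.single j (1 : ℤ))) = _
    rw [map_zsmul, map_add, zsmul_add]
    rfl
  rw [← hmk, h0]

/-- `2P e_m ∈ Γ` for an in-plane axis `m ∈ {i, j}` forces `M_u ∣ P`. -/
theorem dvd_of_two_smul_tiltedUnit_eq_zero (hij : i ≠ j) {m : Fin d} (hm : m = i ∨ m = j) {P : ℕ}
    (h0 : ((2 * P : ℕ) : ℤ) • tiltedUnit d i j Mu Mv L m = 0) : Mu ∣ P := by
  have hmk : ((((2 * P : ℕ) : ℤ) • Pi.single m (1 : ℤ) : Fin d → ℤ) : TiltedSite d i j Mu Mv L) =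
      ((2 * P : ℕ) : ℤ) • tiltedUnit d i j Mu Mv L m := by
    show QuotientAddGroup.mk' (tiltedLattice d i j Mu Mv L)
        (((2 * P : ℕ) : ℤ) • (Pi.single m (1 : ℤ) : Fin d → ℤ)) = _
    rw [map_zsmul]
    rfl
  rw [← hmk, QuotientAddGroup.eq_zero_iff, mem_tiltedLattice_iff] at h0
  obtain ⟨h1, -, -⟩ := h0
  have hsum : (((2 * P : ℕ) : ℤ) • Pi.single m (1 : ℤ) : Fin d → ℤ) i +
      (((2 * P : ℕ) : ℤ) • Pi.single m (1 : ℤ) : Fin d → ℤ) j = 2 * P := by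
    rcases hm with rfl | rfl
    · simp [Pi.single_eq_of_ne hij.symm]
    · simp [Pi.single_eq_of_ne hij]
  rw [hsum] at h1
  have h2 : ((Mu : ℕ) : ℤ) ∣ (P : ℤ) := by
    have h1' : (2 : ℤ) * Mu ∣ 2 * P := by push_cast at h1; exact h1
    exact (mul_dvd_mul_iff_left two_ne_zero).1 h1'
  exact Int.natCast_dvd_natCast.1 h2

/-- **No site frame along the in-plane axes of a tilted box.** For every tilted box
`ℤ^d / Γ(M_u, M_v, L)` (`M_u ≥ 1`, `i ≠ j`), every in-plane axis `m ∈ {i, j}`, every additive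
reflection `θ`, half period `P` and height `h`: `¬ IsSiteFrame e m θ P h`. Hence neither the site-RP
theorem (`IsSiteFrame.integral_conj_mul_nonneg`) nor the link-RP theorem
(`IsSiteFrame.linkRP_integral_conj_mul_nonneg`) of the tree produces a block along `i` or `j`. -/
theorem not_isSiteFrame_tiltedBox_inPlane [NeZero Mu] (hij : i ≠ j) {m : Fin d} (hm : m = i ∨ m = j)
    (θ : TiltedSite d i j Mu Mv L →+ TiltedSite d i j Mu Mv L) (P : ℕ)
    (h : TiltedSite d i j Mu Mv L →+ ZMod (2 * P)) :
    ¬ IsSiteFrame (tiltedUnit d i j Mu Mv L) m θ P h := by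
  intro hF
  have hP := hF.two_le
  haveI : NeZero (2 * P) := ⟨by omega⟩
  -- the height of `M_u (e_i + e_j) = 0` is `M_u (h e_i + h e_j) = M_u`
  have hsum : h (tiltedUnit d i j Mu Mv L i) + h (tiltedUnit d i j Mu Mv L j) = 1 := by
    rcases hm with rfl | rfl
    · rw [hF.height_self, hF.height_other j hij.symm, add_zero]
    · rw [hF.height_self, hF.height_other i hij, zero_add]
  have h1 : (2 * P) ∣ Mu := by
    have h0 := congrArg h (tiltedUnit_inPlane_sum_eq_zero d Mu Mv L hij)
    rw [map_add, map_zsmul, map_zsmul, ← zsmul_add, hsum, map_zero, zsmul_eq_mul, mul_one,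
      Int.cast_natCast] at h0
    exact (ZMod.natCast_eq_zero_iff _ _).1 h0
  -- the layer site `P e_m` has height `P`, so it is fixed; but `θ (P e_m) = -P e_m`
  have h2 : Mu ∣ P := by
    set x₀ : TiltedSite d i j Mu Mv L := (P : ℤ) • tiltedUnit d i j Mu Mv L m with hx₀
    have hhx : h x₀ = (P : ZMod (2 * P)) := by
      rw [hx₀, map_zsmul, hF.height_self, zsmul_eq_mul, mul_one, Int.cast_natCast]
    have hfix := hF.fix_of_layer x₀ (Or.inr hhx)
    have hθ : θ x₀ = -x₀ := by
      rw [hx₀, map_zsmul, hF.map_e_self, zsmul_neg]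
    rw [hθ, neg_eq_iff_add_eq_zero, hx₀, ← add_zsmul] at hfix
    refine dvd_of_two_smul_tiltedUnit_eq_zero d Mu Mv L hij hm ?_
    rw [show (((2 * P : ℕ) : ℤ)) = (P : ℤ) + P by push_cast; ring]
    exact hfix
  have hMu : 0 < Mu := Nat.pos_of_ne_zero (NeZero.ne Mu)
  have h3 : 2 * P ≤ Mu := Nat.le_of_dvd hMu h1
  have h4 : Mu ≤ P := Nat.le_of_dvd (by omega) h2
  omega

end NoFrame

/-! ## The square box of even side parameter: the axis flip, the coordinate, the moved layer -/

section Box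

variable (d : ℕ) {i j : Fin d} (L : ℕ)

/-- **The axis flip `[x] ↦ [x_i ↦ -x_i]` of the square tilted box** `M_u = M_v = M` (a symmetry of
`Γ` exactly when `M_u = M_v`, `tiltedLattice_le_comap_negHom_left`). -/
def tiltedAxisFlip (M : ℕ) (hij : i ≠ j) : TiltedSite d i j M M L →+ TiltedSite d i j M M L :=
  tiltedFlip d M M L i (tiltedLattice_le_comap_negHom_left d L hij)

/-- The axis flip on classes. -/
theorem tiltedAxisFlip_mk (M : ℕ) (hij : i ≠ j) (x : Fin d → ℤ) :
    tiltedAxisFlip d L M hij (x : TiltedSite d i j M M L) =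
      ((negHom d i x : Fin d → ℤ) : TiltedSite d i j M M L) := rfl

/-- The axis flip of the square box is an axis flip of the periodic lattice along `i`. -/
theorem isAxisFlip_tiltedAxisFlip (M : ℕ) (hij : i ≠ j) :
    IsAxisFlip (tiltedUnit d i j M M L) i (tiltedAxisFlip d L M hij) :=
  isAxisFlip_tiltedFlip d M M L i _

variable (P : ℕ)

/-- **The coordinate `x_i mod 2P` of the square box of side parameter `M_u = M_v = 2P`** (well
defined: `x ∈ Γ` gives `4P ∣ (x_i + x_j) + (x_i - x_j) = 2 x_i`). -/
def tiltedAxisCoord : TiltedSite d i j (2 * P) (2 * P) L →+ ZMod (2 * P) :=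
  QuotientAddGroup.lift _
    ((Int.castAddHom (ZMod (2 * P))).comp (Pi.evalAddMonoidHom (fun _ : Fin d => ℤ) i))
    (by
      intro x hx
      rw [mem_tiltedLattice_iff] at hx
      obtain ⟨h1, h2, -⟩ := hx
      rw [AddMonoidHom.mem_ker]
      simp only [AddMonoidHom.coe_comp, Function.comp_apply, Pi.evalAddMonoidHom_apply,
        Int.coe_castAddHom, ZMod.intCast_zmod_eq_zero_iff_dvd]
      have h3 : (((2 * (2 * P) : ℕ)) : ℤ) ∣ (x i + x j) + (x i - x j) := dvd_add h1 h2
      rw [show x i + x j + (x i - x j) = 2 * x i by ring] at h3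
      have h4 : (2 : ℤ) * (2 * P) ∣ 2 * x i := by push_cast at h3; exact h3
      have h5 := (mul_dvd_mul_iff_left (two_ne_zero : (2 : ℤ) ≠ 0)).1 h4
      push_cast
      exact h5)

/-- The coordinate on classes. -/
theorem tiltedAxisCoord_mk (x : Fin d → ℤ) :
    tiltedAxisCoord d L P (x : TiltedSite d i j (2 * P) (2 * P) L) = ((x i : ℤ) : ZMod (2 * P)) :=
  rfl

/-- The flip negates the coordinate: `x_i(θ q) = -x_i(q)`. -/
theorem tiltedAxisCoord_tiltedAxisFlip (hij : i ≠ j) (q : TiltedSite d i j (2 * P) (2 * P) L) :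
    tiltedAxisCoord d L P (tiltedAxisFlip d L (2 * P) hij q) = -tiltedAxisCoord d L P q := by
  induction q using QuotientAddGroup.induction_on with
  | H x =>
    rw [tiltedAxisFlip_mk, tiltedAxisCoord_mk, tiltedAxisCoord_mk, negHom_apply, if_pos rfl,
      Int.cast_neg]

/-- The coordinate of `x + e_j` equals that of `x`. -/
theorem tiltedAxisCoord_add_unit_right (hij : i ≠ j) (q : TiltedSite d i j (2 * P) (2 * P) L) :
    tiltedAxisCoord d L P (q + tiltedUnit d i j (2 * P) (2 * P) L j) = tiltedAxisCoord d L P q := by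
  rw [map_add]
  have h0 : tiltedAxisCoord d L P (tiltedUnit d i j (2 * P) (2 * P) L j) = 0 := by
    show tiltedAxisCoord d L P ((Pi.single j (1 : ℤ) : Fin d → ℤ) : TiltedSite d i j (2 * P) (2 * P) L)
      = 0
    rw [tiltedAxisCoord_mk, Pi.single_eq_of_ne hij, Int.cast_zero]
  rw [h0, add_zero]

/-- The layer site `[P e_i]` of the square box of side parameter `2P`. -/
def layerSite : TiltedSite d i j (2 * P) (2 * P) L :=
  ((Pi.single i (P : ℤ) : Fin d → ℤ) : TiltedSite d i j (2 * P) (2 * P) L)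

/-- The layer site has coordinate `P`. -/
theorem tiltedAxisCoord_layerSite :
    tiltedAxisCoord d L P (layerSite d L P : TiltedSite d i j (2 * P) (2 * P) L) =
      (P : ZMod (2 * P)) := by
  rw [layerSite, tiltedAxisCoord_mk, Pi.single_eq_same, Int.cast_natCast]

/-- **The layer `x_i ≡ P` is NOT pointwise fixed**: `θ_i [P e_i] = [-P e_i] ≠ [P e_i]`, because
`2P e_i ∉ Γ` (`x_i + x_j = 2P` is not divisible by `4P` for `P ≥ 1`). -/
theorem tiltedAxisFlip_layerSite_ne [NeZero P] (hij : i ≠ j) :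
    tiltedAxisFlip d L (2 * P) hij (layerSite d L P) ≠ (layerSite d L P : TiltedSite d i j _ _ L) := by
  intro h
  rw [layerSite, tiltedAxisFlip_mk, QuotientAddGroup.eq, mem_tiltedLattice_iff] at h
  obtain ⟨h1, -, -⟩ := h
  have hsum : (-(negHom d i (Pi.single i (P : ℤ))) + Pi.single i (P : ℤ) : Fin d → ℤ) i +
      (-(negHom d i (Pi.single i (P : ℤ))) + Pi.single i (P : ℤ) : Fin d → ℤ) j = 2 * P := by
    simp only [Pi.add_apply, Pi.neg_apply, negHom_apply, ↓reduceIte, if_neg hij.symm,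
      Pi.single_eq_same, Pi.single_eq_of_ne hij.symm, neg_neg, neg_zero, add_zero]
    ring
  rw [hsum] at h1
  have hP : 0 < P := Nat.pos_of_ne_zero (NeZero.ne P)
  have h2 := Int.le_of_dvd (by positivity) h1
  push_cast at h2
  omega

/-- Both `j`-links based at the layer site and at its flip image lie in the closed half
`{0 ≤ x_i ≤ P (mod 2P)}`. -/
theorem isHalfLink_layerSite [NeZero P] (hij : i ≠ j) :
    IsHalfLink (tiltedUnit d i j (2 * P) (2 * P) L) P (tiltedAxisCoord d L P) (layerSite d L P, j) ∧
      IsHalfLink (tiltedUnit d i j (2 * P) (2 * P) L) P (tiltedAxisCoord d L P)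
        (tiltedAxisFlip d L (2 * P) hij (layerSite d L P), j) := by
  have hP : 0 < P := Nat.pos_of_ne_zero (NeZero.ne P)
  have hval : ((P : ZMod (2 * P))).val = P := by
    rw [ZMod.val_natCast]; exact Nat.mod_eq_of_lt (by omega)
  have h0 : tiltedAxisCoord d L P (layerSite d L P : TiltedSite d i j _ _ L) = (P : ZMod (2 * P)) :=
    tiltedAxisCoord_layerSite d L P
  have h1 : tiltedAxisCoord d L P (tiltedAxisFlip d L (2 * P) hij (layerSite d L P)) =
      (P : ZMod (2 * P)) := by
    rw [tiltedAxisCoord_tiltedAxisFlip, h0, neg_natCast_self]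
  refine ⟨⟨?_, ?_⟩, ⟨?_, ?_⟩⟩
  · show (tiltedAxisCoord d L P (layerSite d L P : TiltedSite d i j _ _ L)).val ≤ P
    rw [h0, hval]
  · show (tiltedAxisCoord d L P ((layerSite d L P : TiltedSite d i j _ _ L) +
      tiltedUnit d i j (2 * P) (2 * P) L j)).val ≤ P
    rw [tiltedAxisCoord_add_unit_right d L P hij, h0, hval]
  · show (tiltedAxisCoord d L P (tiltedAxisFlip d L (2 * P) hij (layerSite d L P))).val ≤ P
    rw [h1, hval]
  · show (tiltedAxisCoord d L P (tiltedAxisFlip d L (2 * P) hij (layerSite d L P) +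
      tiltedUnit d i j (2 * P) (2 * P) L j)).val ≤ P
    rw [tiltedAxisCoord_add_unit_right d L P hij, h1, hval]

end Box

/-! ## The negative on the tilted box -/

section Main

variable {d : ℕ} {i j : Fin d} {P L N : ℕ} [NeZero P] [NeZero L]
variable {G : Type*} [Group G] [TopologicalSpace G] [IsTopologicalGroup G] [CompactSpace G]
  [MeasurableSpace G] [BorelSpace G] [SecondCountableTopology G]
variable (ρ : G →* Matrix (Fin N) (Fin N) ℂ)

/-- **Axis reflection positivity FAILS on the square tilted box of even side parameter, at every
coupling.** Box `ℤ^d / Γ(2P, 2P, L)` (`P ≥ 1`, `L ≥ 1`, `i ≠ j`), `Θ_i` the flip along `i`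
(`configReflect … i (tiltedAxisFlip …)`: `i`-links reversed and inverted), closed half
`{0 ≤ x_i ≤ P (mod 2P)}`; `G` non-trivial compact Hausdorff second countable, `ρ` continuous,
`β ∈ ℝ` arbitrary. There is a measurable `F`, `‖F‖ ≤ 1`, an observable of the closed half
(`IsHalfObservable`, it depends only on the two `j`-links based at `[P e_i]` and `[-P e_i]`), odd
under `Θ_i`, with `∫ conj F(Θ_i U) · F(U) dμ_β < 0`. -/
theorem tiltedBox_axisRP_neg [Nontrivial G] [T2Space G] (hij : i ≠ j) (hρ : Continuous ρ) (β : ℝ) :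
    ∃ F : Config (TiltedSite d i j (2 * P) (2 * P) L) d G → ℂ, Measurable F ∧ (∀ U, ‖F U‖ ≤ 1) ∧
      IsHalfObservable (tiltedUnit d i j (2 * P) (2 * P) L) P (tiltedAxisCoord d L P) F ∧
      (∀ U, F (configReflect (tiltedUnit d i j (2 * P) (2 * P) L) i (tiltedAxisFlip d L (2 * P) hij) U)
        = -F U) ∧
      ∫ U, conj (F (configReflect (tiltedUnit d i j (2 * P) (2 * P) L) i
          (tiltedAxisFlip d L (2 * P) hij) U)) * F U ∂(gibbs ρ (tiltedUnit d i j (2 * P) (2 * P) L) β)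
        < 0 := by
  obtain ⟨F, hFm, hFb, hFdep, hFodd, hneg⟩ :=
    (isAxisFlip_tiltedAxisFlip d L (2 * P) hij).exists_integral_conj_mul_neg ρ hρ β hij.symm
      (tiltedAxisFlip_layerSite_ne d L P hij)
  refine ⟨F, hFm, hFb, fun U V hUV => ?_, hFodd, hneg⟩
  obtain ⟨hl₁, hl₂⟩ := isHalfLink_layerSite d L P hij
  exact hFdep U V (hUV _ hl₁) (hUV _ hl₂)

/-- **Corollary: closed-half axis reflection positivity, in the shape of `tiltedBox_siteRP`, is
FALSE along the axis `i` of the square tilted box of even side parameter** (every real `β`, every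
non-trivial compact Hausdorff second countable `G`, continuous `ρ`). With
`not_isSiteFrame_tiltedBox_inPlane` this completes the cone of the tilted box on the negative side:
the in-plane flips are symmetries of `μ_β` (`tiltedBox_integral_comp_flip`), not reflections of
positive type. -/
theorem not_tiltedBox_axisRP [Nontrivial G] [T2Space G] (hij : i ≠ j) (hρ : Continuous ρ) (β : ℝ) :
    ¬ ∀ F : Config (TiltedSite d i j (2 * P) (2 * P) L) d G → ℂ, Measurable F →
        (∃ C : ℝ, ∀ U, ‖F U‖ ≤ C) →
        IsHalfObservable (tiltedUnit d i j (2 * P) (2 * P) L) P (tiltedAxisCoord d L P) F →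
        0 ≤ ∫ U, conj (F (configReflect (tiltedUnit d i j (2 * P) (2 * P) L) i
          (tiltedAxisFlip d L (2 * P) hij) U)) * F U ∂(gibbs ρ (tiltedUnit d i j (2 * P) (2 * P) L) β) := by
  intro hRP
  obtain ⟨F, hFm, hFb, hFo, -, hneg⟩ := tiltedBox_axisRP_neg (P := P) (L := L) ρ hij hρ β
  exact lt_irrefl _ (lt_of_le_of_lt (hRP F hFm ⟨1, hFb⟩ hFo) hneg)

end Main

end TiltedRP

end Summit.QuantumFields.GaugeBoot
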